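import Summits.Langlands.Langlands.Theses.IrreducibilityBySelfDuality

/-!
# Disproof of `GaloisRepGL2CMae` (crux stmt-Langlands-16722) — findings: NO KILL (cdisprove cycle 1)

Crux (route `IrreducibilityBySelfDuality`, rank 8): for `K` CM, `σ` regular algebraic cuspidal on
`GL₂(𝔸_K)`, every `ℓ`, `ι : ℚ̄_ℓ ≃+* ℂ`, SOME continuous `ρ : Γ_K → GL₂(ℚ̄_ℓ)` with, at all but
finitely many `v`, `σ_v` Satake `β` ⇒ `ρ` unramified at `v` and
`charpoly ρ(Frob_v^arith) = arithFrobPolyOfSatake ι q_v 2 β = ∏_{b ∈ β} (X - ι⁻¹((√q_v · b)⁻¹))`.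
This is Harris–Lan–Taylor–Thorne 2016 Thm A (= Cor 7.14) / Scholze 2015 Cor V.4.2 at `n = 2`,
WEAKENED (CM only, a.e. `v` only, existence half only, no semisimplicity).

## Verdict of this cycle
* **No refutation.** The statement is a printed theorem transcribed over an interface that I
  re-audited symbol by symbol (§0 below): `HasSatakeParamAt` (unitary Satake–Tamagawa
  normalisation `t_{v,i} ↦ q^{i(n-i)/2} e_i`), `arithFrobPolyOfSatake ι q 2 β` (arithmetic
  Frobenius, roots `(√q b)⁻¹` = inverses of the HLTT Hecke roots `q^{(n-1)/2} b`),
  `HasFrobCharpolyAt` (Mathlib `IsArithFrobAt`, every Frobenius at every `𝔓 ∣ v`),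
  `IsRegularAlgebraic` (C-algebraic + regular infinitesimal character = HLTT's hypothesis
  "same infinitesimal character as an algebraic representation of `Res GL_n`", pairing-free, so
  the tree's pairing-blind `HasInfinityType` loses nothing here), `IsCMField` (Mathlib: totally
  complex + quadratic over the maximal real subfield). All consistent with print.
* **Convention robustness** (why a slip could not even have made it false): an arithmetic ↔
  geometric Frobenius slip is absorbed by `ρ ↦ ρ^∨`; a Hecke-operator slip `t ↦ t⁻¹` replaces `β`
  by `β⁻¹` = Satake parameter of `σ^∨`, also regular algebraic cuspidal; only the half-twist
  `m = 2` is load-bearing (with `m = 1` the statement is false for generic `ι`: it would need a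
  continuous character `Frob_v ↦ ι⁻¹(√q_v)`, whose sign pattern over split primes is arbitrary in
  `ι` and hence not Chebotarev-periodic) — and `m = 2 = n` is what the text has.
* **Junk witnesses excluded, kernel-checked (§B):** the trivial representation witnesses the
  conclusion at `v` only for `β ⊆ {q_v^{-1/2}}` (`trivial_witness_forces`), i.e. the Satake
  parameter of the Eisenstein constituent `|det|^{1/2} ⊗ (1 ⊞ 1)`, never cuspidal; and ANY witness
  pins `β` (`witness_pins_satake`: the conclusion at `v` for `β` and `β'` forces `β = β'`), so the
  "two Satake parameters" attack needs non-uniqueness of `HasSatakeParamAt`, refuted in tree by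
  `AutomorphicRepData.hasSatakeParamAt_unique_holds` (PROVED, std axioms); vacuity of
  `HasFrobCharpolyAt` is excluded by `primesAbove_nonempty` +
  `exists_isArithFrobAt_of_mem_primesAbove_holds` (PROVED).
* **Load-bearing analysis (§A, paper verdicts; the in-Lean `_false_without_` theorems are
  BLOCKED, see "Why it resists"):**
  - `IsCMField`: NOT load-bearing for truth — `CruxTRorCM` is lang.S27 at `n = 2` a.e.
    (`TRorCM_of_S27`, kernel-checked) and `CruxWithoutCM` (all number fields) is an OPEN
    CONJECTURE (mixed-signature `K`: no Galois representations known or refuted). Consequence for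
    lines (a barrier-type remark): a mechanism that never uses the CM structure (complex
    conjugation / `U(n)` relative to `K/K⁺` / a Shimura variety over `K⁺`) proves `CruxWithoutCM`,
    i.e. too much.
  - `IsRegularAlgebraic`: LOAD-BEARING. Drop it (`CruxWithoutRegularAlgebraic`): FALSE on paper —
    witness `σ ⊗ |det|^{1/3}` (cuspidal, not algebraic; realisable in tree from any `σ` by
    `CuspidalAutomorphicRepData.exists_twist_hecke_hasSatakeParamAt`): a witness `ρ'` would give the
    continuous character `det ρ' · (det ρ_σ)⁻¹ : Frob_v ↦ ι⁻¹(q_v^{-2/3})`, and for `ι` whose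
    cube-root pattern `ι⁻¹(p^{1/3}) / (p^{1/3})_ℓ ∈ μ₃` over split `p` is not the splitting pattern
    of a `ℤ/3`-extension (Kummer: the patterns realised by `Aut ℂ` are ALL of `∏_p μ₃`) no such
    character exists. Weaken to C-algebraic, regularity dropped (`CruxCAlgebraic`): OPEN (irregular =
    "weight one" over CM fields; only partial results in print).
  - cuspidality: NOT load-bearing at `n = 2` (`CruxAutomorphic`, paper TRUE: the RA non-cuspidal
    constituents of `GL₂` are `χ∘det` and subquotients of `χ₁ ⊞ χ₂`, with `ρ = ψ₁ ⊕ ψ₂`).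
  - the cofinite filter: LOAD-BEARING against "every `v`" (`CruxEverywhere`, paper FALSE: `ρ_{σ,ℓ}`
    has Hodge–Tate weights not all zero, hence is ramified at every `v ∣ ℓ`, while `σ` is
    unramified at almost every `v ∣ ℓ`); NOT load-bearing against "every `v ∤ ℓ` carrying a Satake
    parameter" (`CruxAwayFromL` = lang.S27 shape, paper TRUE by Varma 2024, `awayFromL_of_S27`).
  - semisimplicity / irreducibility of `ρ` (strengthenings `CruxSemisimple`): TRUE in print (HLTT
    gives semisimple; irreducible for RA cuspidal `GL₂` over CM is known) — harmlessly omitted.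
* **Why it resists (for the provers and the next disprover).** (1) It is a theorem in print and the
  item is WEAKER than print. (2) Every in-Lean negative lemma about a mutation needs an inhabitant
  of `CuspidalAutomorphicRepData 2 K hcpt` (no cusp form is constructed anywhere in the tree —
  hypothesis `H_σ` below) AND a Galois-side rigidity input absent from tree and Mathlib (continuous
  characters of `Γ_K` are determined by Frobenius values on a density-one set; finite-order
  Frobenius patterns are Chebotarev-periodic) or a transcendence input (Gelfond–Schneider, to pick
  a bad `ι`). The one cheap Galois-side invariant, `‖det ρ(Frob_v)‖_ℓ = 1` (compact image), does
  not separate `σ` from its `|det|^{1/3}`-twists (cube roots of units are units). So no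
  `--negative-modulo H` lemma with a clean `H` is available either: recorded, not filed.
* Anchors already in tree (cited, not re-proved): `theoremA_existence → Crux`
  (`GaloisRepOfRegularAlgebraic.gl2CM_ae_of_theoremA_existence`, p124798), `lang.S27 item → Crux`
  (`gl2CM_ae_of_item`), leaves → Crux (`GaloisRepGL2CMaeOfLeaves_proof`, item 16776 closed).
* Targets (lead's stuck stubs): none this cycle (`payload.stuck_stubs = []`, no line picked).

Prose lives in docstrings only; everything below elaborates with 0 sorries.
-/

noncomputable section

set_option linter.dupNamespace false -- `Summit.Langlands.Langlands` is the mandated namespace (lakefile weak option)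

namespace Summit.Langlands.Langlands.Cruxes.GaloisRepGL2CMae.Disproof

open scoped Classical NumberField
open Literature.NumberTheory.GaloisRepresentations Literature.NumberTheory.Automorphic
open IsDedekindDomain NumberField Polynomial Filter

/-! ## §0 The crux by name, and its one-place clause -/

/-- The crux under attack, by name. [folklore] -/
abbrev Crux : Prop := Summit.Langlands.Langlands.Theses.IrreducibilityBySelfDuality.GaloisRepGL2CMae

/-- Read-back: the crux is literally "∃ ρ, ∀ᶠ v, IsGaloisCompatibleAt σ ι ρ v" with the tree's
HLTT compatibility clause `IsGaloisCompatibleAt` (ReciprocityGLnProofs) — definitional. [folklore] -/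
theorem crux_iff_isGaloisCompatibleAt :
    Crux ↔ ∀ (K : Type) [Field K] [NumberField K] (hcpt₂ : isCompact_glFiniteIntegralLevel 2 K),
      IsCMField K → ∀ (σ : CuspidalAutomorphicRepData 2 K hcpt₂), σ.1.IsRegularAlgebraic →
      ∀ (ℓ : ℕ) [Fact ℓ.Prime] (ι : PadicAlgCl ℓ ≃+* ℂ), ∃ ρ : FramedGaloisRep K (PadicAlgCl ℓ) 2,
      ∀ᶠ v : HeightOneSpectrum (𝓞 K) in cofinite, IsGaloisCompatibleAt σ.1 ι ρ v :=
  Iff.rfl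

/-! ## §A Load-bearing analysis: the mutations, and how each relates to the crux

Every `def` below is the crux with ONE hypothesis dropped / weakened / strengthened; the
implications to or from the crux are kernel-checked; the truth value ON PAPER is in the docstring
(none of the `¬ Mutation` statements is formalisable today: each needs `H_σ`). -/

/-- `H_σ`: the existence hypothesis every in-Lean negative lemma about this crux would need — a CM
field with a regular algebraic cuspidal `GL₂` datum (true: e.g. `K = ℚ(i)`, `σ` = base change of
the weight-2 newform of level 11; NOT constructible in the tree, which has no cusp form). Recorded
as the `H` of a would-be `--negative-modulo H` lemma; no such lemma is filed because the Galois-side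
half of every mutation's refutation is also out of reach (module docstring). [folklore] -/
def HSigma : Prop :=
  ∃ (K : Type) (_ : Field K) (_ : NumberField K) (hcpt₂ : isCompact_glFiniteIntegralLevel 2 K)
    (σ : CuspidalAutomorphicRepData 2 K hcpt₂), IsCMField K ∧ σ.1.IsRegularAlgebraic

/-- MUTATION 1 (drop `IsCMField`): Galois representations, a.e., for regular algebraic cuspidal `GL₂`
over EVERY number field. Paper status: OPEN CONJECTURE (unknown already for a cubic field with one
complex place; known for totally real `K` — Carayol, Taylor, Blasius–Rogawski — and CM `K` — HLTT,
Scholze). Not refutable; `IsCMField` is load-bearing for PROVABILITY only. [folklore] -/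
def CruxWithoutCM : Prop :=
  ∀ (K : Type) [Field K] [NumberField K] (hcpt₂ : isCompact_glFiniteIntegralLevel 2 K)
    (σ : CuspidalAutomorphicRepData 2 K hcpt₂), σ.1.IsRegularAlgebraic →
    ∀ (ℓ : ℕ) [Fact ℓ.Prime] (ι : PadicAlgCl ℓ ≃+* ℂ), ∃ ρ : FramedGaloisRep K (PadicAlgCl ℓ) 2,
    ∀ᶠ v : HeightOneSpectrum (𝓞 K) in cofinite, ∀ β : Multiset ℂ, σ.1.HasSatakeParamAt v β →
      ρ.IsUnramifiedAt v ∧ ρ.HasFrobCharpolyAt v (arithFrobPolyOfSatake ι v.residueCard 2 β)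

/-- The CM-free mutation implies the crux (monotonicity). [folklore] -/
theorem crux_of_withoutCM (h : CruxWithoutCM) : Crux :=
  fun K _ _ hcpt₂ _ σ hσ ℓ _ ι => h K hcpt₂ σ hσ ℓ ι

/-- MUTATION 1′ (`IsCMField` ↦ `IsTotallyReal ∨ IsCMField`): lang.S27 at `n = 2`, a.e. form.
Paper status: TRUE (HLTT Thm A covers both). [cite: HarrisLanTaylorThorneRMS2016, Thm. A] -/
def CruxTRorCM : Prop :=
  ∀ (K : Type) [Field K] [NumberField K] (hcpt₂ : isCompact_glFiniteIntegralLevel 2 K),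
    (IsTotallyReal K ∨ IsCMField K) →
    ∀ (σ : CuspidalAutomorphicRepData 2 K hcpt₂), σ.1.IsRegularAlgebraic →
    ∀ (ℓ : ℕ) [Fact ℓ.Prime] (ι : PadicAlgCl ℓ ≃+* ℂ), ∃ ρ : FramedGaloisRep K (PadicAlgCl ℓ) 2,
    ∀ᶠ v : HeightOneSpectrum (𝓞 K) in cofinite, ∀ β : Multiset ℂ, σ.1.HasSatakeParamAt v β →
      ρ.IsUnramifiedAt v ∧ ρ.HasFrobCharpolyAt v (arithFrobPolyOfSatake ι v.residueCard 2 β)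

/-- The `TR ∨ CM` mutation implies the crux. [folklore] -/
theorem crux_of_TRorCM (h : CruxTRorCM) : Crux :=
  fun K _ _ hcpt₂ hK σ hσ ℓ _ ι => h K hcpt₂ (Or.inr hK) σ hσ ℓ ι

/-- The `TR ∨ CM` mutation follows from the Literature named fact lang.S27
(`exists_galoisRep_of_regularAlgebraic`, HLTT + Scholze + Varma) at `n = 2`: the finitely many
`v ∣ ℓ` are absorbed by the cofinite filter (`FramedGaloisRep.eventually_natCast_not_mem`).
[cite: HarrisLanTaylorThorneRMS2016, Thm. A] -/
theorem TRorCM_of_S27 (h : exists_galoisRep_of_regularAlgebraic) : CruxTRorCM := by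
  intro K _ _ hcpt₂ hK σ hσ ℓ _ ι
  obtain ⟨r, -, hr⟩ := h hcpt₂ hK σ hσ ℓ ι
  exact ⟨r, (FramedGaloisRep.eventually_natCast_not_mem K ℓ).mono fun v hv β hβ => hr v β hβ hv⟩

/-- MUTATION 2 (drop `IsRegularAlgebraic`): Galois representations for EVERY cuspidal `σ` on `GL₂`
over a CM field. Paper status: FALSE — witness `σ ⊗ |det|^{1/3}` for `σ` regular algebraic (in tree:
`CuspidalAutomorphicRepData.exists_twist_hecke_hasSatakeParamAt` twists any cuspidal datum by any
Hecke character at Satake level): a witness `ρ'` for it and `ρ` for `σ` give the continuous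
character `det ρ' (det ρ)⁻¹ : Frob_v ↦ ι⁻¹(q_v^{-2/3})` a.e.; modulo the canonical cube root of
`χ_cyc⁻²` (which exists for `ℓ ∤ 3`, `3 ∤ ℓ - 1`) this is a continuous `μ₃`-valued character whose
Frobenius pattern over split rational primes is the pattern `p ↦ ι⁻¹(p^{1/3}) / (p^{1/3})_ℓ`, and by
Kummer theory (`Gal(ℚ(ζ₃, {p^{1/3}})/ℚ(ζ₃)) = ∏_p ℤ/3`) every pattern arises from some `ι`,
whereas only Chebotarev-periodic patterns come from `ℤ/3`-extensions of `K`: contradiction for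
generic `ι`. So regular-algebraicity is the LOAD-BEARING hypothesis. In-Lean refutation blocked
(needs `H_σ` and the Chebotarev/CFT rigidity of continuous characters). [folklore] -/
def CruxWithoutRegularAlgebraic : Prop :=
  ∀ (K : Type) [Field K] [NumberField K] (hcpt₂ : isCompact_glFiniteIntegralLevel 2 K),
    IsCMField K → ∀ (σ : CuspidalAutomorphicRepData 2 K hcpt₂)
    (ℓ : ℕ) [Fact ℓ.Prime] (ι : PadicAlgCl ℓ ≃+* ℂ), ∃ ρ : FramedGaloisRep K (PadicAlgCl ℓ) 2,
    ∀ᶠ v : HeightOneSpectrum (𝓞 K) in cofinite, ∀ β : Multiset ℂ, σ.1.HasSatakeParamAt v β →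
      ρ.IsUnramifiedAt v ∧ ρ.HasFrobCharpolyAt v (arithFrobPolyOfSatake ι v.residueCard 2 β)

/-- The regularity-free mutation implies the crux. [folklore] -/
theorem crux_of_withoutRegularAlgebraic (h : CruxWithoutRegularAlgebraic) : Crux :=
  fun K _ _ hcpt₂ hK σ _ ℓ _ ι => h K hcpt₂ hK σ ℓ ι

/-- MUTATION 2′ (weaken `IsRegularAlgebraic` to `IsCAlgebraic`, i.e. allow irregular algebraic
weight): Paper status: OPEN ("weight one over CM fields": Galois representations for irregular
C-algebraic cuspidal `GL₂` over CM fields are not known in general; `C`-normalisation with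
`m = 2` is the right one for C-algebraic `σ`). Not refutable. [folklore] -/
def CruxCAlgebraic : Prop :=
  ∀ (K : Type) [Field K] [NumberField K] (hcpt₂ : isCompact_glFiniteIntegralLevel 2 K),
    IsCMField K → ∀ (σ : CuspidalAutomorphicRepData 2 K hcpt₂), σ.1.IsCAlgebraic →
    ∀ (ℓ : ℕ) [Fact ℓ.Prime] (ι : PadicAlgCl ℓ ≃+* ℂ), ∃ ρ : FramedGaloisRep K (PadicAlgCl ℓ) 2,
    ∀ᶠ v : HeightOneSpectrum (𝓞 K) in cofinite, ∀ β : Multiset ℂ, σ.1.HasSatakeParamAt v β →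
      ρ.IsUnramifiedAt v ∧ ρ.HasFrobCharpolyAt v (arithFrobPolyOfSatake ι v.residueCard 2 β)

/-- The C-algebraic mutation implies the crux (`IsRegularAlgebraic.isCAlgebraic`). [folklore] -/
theorem crux_of_CAlgebraic (h : CruxCAlgebraic) : Crux :=
  fun K _ _ hcpt₂ hK σ hσ ℓ _ ι => h K hcpt₂ hK σ hσ.isCAlgebraic ℓ ι

/-- MUTATION 3 (drop cuspidality: any automorphic representation datum of `GL₂(𝔸_K)`).
Paper status: TRUE (expected; the regular algebraic non-cuspidal irreducible subquotients of the
space of automorphic forms on `GL₂` are one-dimensional `χ ∘ det` and constituents of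
`χ₁ ⊞ χ₂` with `χ_i` algebraic Hecke characters; `ρ = ψ_{χ₁} ⊕ ψ_{χ₂}` with Weil's `ℓ`-adic
avatars works). So cuspidality is NOT load-bearing at `n = 2`; it is in the crux because the
consumer (`essSelfDualIrreducibleCM_of_gl2CM_ae`) holds a cuspidal datum. [folklore] -/
def CruxAutomorphic : Prop :=
  ∀ (K : Type) [Field K] [NumberField K] (hcpt₂ : isCompact_glFiniteIntegralLevel 2 K),
    IsCMField K → ∀ (σ : AutomorphicRepData (AutomorphyDatum.gl 2 K hcpt₂)), σ.IsRegularAlgebraic →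
    ∀ (ℓ : ℕ) [Fact ℓ.Prime] (ι : PadicAlgCl ℓ ≃+* ℂ), ∃ ρ : FramedGaloisRep K (PadicAlgCl ℓ) 2,
    ∀ᶠ v : HeightOneSpectrum (𝓞 K) in cofinite, ∀ β : Multiset ℂ, σ.HasSatakeParamAt v β →
      ρ.IsUnramifiedAt v ∧ ρ.HasFrobCharpolyAt v (arithFrobPolyOfSatake ι v.residueCard 2 β)

/-- The cuspidality-free mutation implies the crux. [folklore] -/
theorem crux_of_automorphic (h : CruxAutomorphic) : Crux :=
  fun K _ _ hcpt₂ hK σ hσ ℓ _ ι => h K hcpt₂ hK σ.1 hσ ℓ ι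

/-- MUTATION 4 (strengthen "almost every `v`" to "every `v` carrying a Satake parameter").
Paper status: FALSE — `ρ_{σ,ℓ}` is Hodge–Tate with weights not all `0` at `v ∣ ℓ`, hence
ramified at every `v ∣ ℓ` (already `det ρ = ε^{-1}·(finite)` up to an algebraic character of
non-zero weight), while `σ` is unramified at all but finitely many `v ∣ ℓ` as `ℓ` varies; e.g. the
base change to `ℚ(i)` of the level-11 newform at any `ℓ ≠ 11` split in `ℚ(i)`. So the cofinite
filter is load-bearing against this strengthening. In-Lean refutation blocked (`H_σ` + Hodge–Tate
theory). [folklore] -/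
def CruxEverywhere : Prop :=
  ∀ (K : Type) [Field K] [NumberField K] (hcpt₂ : isCompact_glFiniteIntegralLevel 2 K),
    IsCMField K → ∀ (σ : CuspidalAutomorphicRepData 2 K hcpt₂), σ.1.IsRegularAlgebraic →
    ∀ (ℓ : ℕ) [Fact ℓ.Prime] (ι : PadicAlgCl ℓ ≃+* ℂ), ∃ ρ : FramedGaloisRep K (PadicAlgCl ℓ) 2,
    ∀ (v : HeightOneSpectrum (𝓞 K)) (β : Multiset ℂ), σ.1.HasSatakeParamAt v β →
      ρ.IsUnramifiedAt v ∧ ρ.HasFrobCharpolyAt v (arithFrobPolyOfSatake ι v.residueCard 2 β)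

/-- The everywhere-strengthening implies the crux (`Eventually.of_forall`). [folklore] -/
theorem crux_of_everywhere (h : CruxEverywhere) : Crux := by
  intro K _ _ hcpt₂ hK σ hσ ℓ _ ι
  obtain ⟨ρ, hρ⟩ := h K hcpt₂ hK σ hσ ℓ ι
  exact ⟨ρ, Eventually.of_forall hρ⟩

/-- MUTATION 4′ (strengthen to "every `v ∤ ℓ` carrying a Satake parameter" — the shape of lang.S27 /
item `GaloisRepOfRegularAlgebraic`, minus semisimplicity). Paper status: TRUE (local–global
compatibility at every unramified `v ∤ ℓ`: Varma 2024 Thm 1 on top of HLTT/Scholze). Harder than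
the crux, implies it. [cite: VarmaFMS2024, Thm. 1 (main theorem)] -/
def CruxAwayFromL : Prop :=
  ∀ (K : Type) [Field K] [NumberField K] (hcpt₂ : isCompact_glFiniteIntegralLevel 2 K),
    IsCMField K → ∀ (σ : CuspidalAutomorphicRepData 2 K hcpt₂), σ.1.IsRegularAlgebraic →
    ∀ (ℓ : ℕ) [Fact ℓ.Prime] (ι : PadicAlgCl ℓ ≃+* ℂ), ∃ ρ : FramedGaloisRep K (PadicAlgCl ℓ) 2,
    ∀ (v : HeightOneSpectrum (𝓞 K)) (β : Multiset ℂ), σ.1.HasSatakeParamAt v β →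
      ((ℓ : ℕ) : 𝓞 K) ∉ v.asIdeal →
      ρ.IsUnramifiedAt v ∧ ρ.HasFrobCharpolyAt v (arithFrobPolyOfSatake ι v.residueCard 2 β)

/-- The away-from-`ℓ` strengthening implies the crux (finitely many `v ∣ ℓ`). [folklore] -/
theorem crux_of_awayFromL (h : CruxAwayFromL) : Crux := by
  intro K _ _ hcpt₂ hK σ hσ ℓ _ ι
  obtain ⟨ρ, hρ⟩ := h K hcpt₂ hK σ hσ ℓ ι
  exact ⟨ρ, (FramedGaloisRep.eventually_natCast_not_mem K ℓ).mono fun v hv β hβ => hρ v β hβ hv⟩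

/-- The away-from-`ℓ` strengthening is lang.S27 at `n = 2` over CM fields. [folklore] -/
theorem awayFromL_of_S27 (h : exists_galoisRep_of_regularAlgebraic) : CruxAwayFromL := by
  intro K _ _ hcpt₂ hK σ hσ ℓ _ ι
  obtain ⟨r, -, hr⟩ := h hcpt₂ (Or.inr hK) σ hσ ℓ ι
  exact ⟨r, hr⟩

/-- MUTATION 5 (strengthen the witness: `ρ` semisimple). Paper status: TRUE (HLTT Thm A gives a
semisimple `r`; for RA cuspidal `GL₂` over CM even irreducible). Harmless omission in the crux
(the consumer never uses semisimplicity). [cite: HarrisLanTaylorThorneRMS2016, Thm. A] -/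
def CruxSemisimple : Prop :=
  ∀ (K : Type) [Field K] [NumberField K] (hcpt₂ : isCompact_glFiniteIntegralLevel 2 K),
    IsCMField K → ∀ (σ : CuspidalAutomorphicRepData 2 K hcpt₂), σ.1.IsRegularAlgebraic →
    ∀ (ℓ : ℕ) [Fact ℓ.Prime] (ι : PadicAlgCl ℓ ≃+* ℂ), ∃ ρ : FramedGaloisRep K (PadicAlgCl ℓ) 2,
    ρ.toGaloisRep.IsSemisimple ∧
    ∀ᶠ v : HeightOneSpectrum (𝓞 K) in cofinite, ∀ β : Multiset ℂ, σ.1.HasSatakeParamAt v β →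
      ρ.IsUnramifiedAt v ∧ ρ.HasFrobCharpolyAt v (arithFrobPolyOfSatake ι v.residueCard 2 β)

/-- The semisimple strengthening implies the crux. [folklore] -/
theorem crux_of_semisimple (h : CruxSemisimple) : Crux := by
  intro K _ _ hcpt₂ hK σ hσ ℓ _ ι
  obtain ⟨ρ, -, hρ⟩ := h K hcpt₂ hK σ hσ ℓ ι
  exact ⟨ρ, hρ⟩

/-- The semisimple strengthening is also a consequence of lang.S27. [folklore] -/
theorem semisimple_of_S27 (h : exists_galoisRep_of_regularAlgebraic) : CruxSemisimple := by
  intro K _ _ hcpt₂ hK σ hσ ℓ _ ι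
  obtain ⟨r, hss, hr⟩ := h hcpt₂ (Or.inr hK) σ hσ ℓ ι
  exact ⟨r, hss, (FramedGaloisRep.eventually_natCast_not_mem K ℓ).mono
    fun v hv β hβ => hr v β hβ hv⟩

/-! ## §B Junk witnesses excluded (kernel-checked small-model facts about the conclusion) -/

section Junk

variable {K : Type} [Field K] [NumberField K] {ℓ : ℕ} [Fact ℓ.Prime]

/-- The root map of `arithFrobPolyOfSatake ι q m` is injective as soon as `q ≠ 0`. [folklore] -/
theorem root_injective (ι : PadicAlgCl ℓ ≃+* ℂ) {q : ℕ} (hq : q ≠ 0) (m : ℕ) :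
    Function.Injective fun a : ℂ => ι.symm (((Real.sqrt q : ℝ) : ℂ) ^ (m - 1) * a)⁻¹ := by
  intro a b hab
  have hq' : ((Real.sqrt q : ℝ) : ℂ) ^ (m - 1) ≠ 0 := by
    apply pow_ne_zero
    have : (0 : ℝ) < Real.sqrt q := Real.sqrt_pos.mpr (by exact_mod_cast Nat.pos_of_ne_zero hq)
    exact_mod_cast this.ne'
  have h1 : (((Real.sqrt q : ℝ) : ℂ) ^ (m - 1) * a)⁻¹ = (((Real.sqrt q : ℝ) : ℂ) ^ (m - 1) * b)⁻¹ :=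
    ι.symm.injective hab
  have h2 := inv_injective h1
  exact mul_left_cancel₀ hq' h2

/-- `arithFrobPolyOfSatake ι q m` is injective in the multiset for `q ≠ 0` (compare roots,
`roots_arithFrobPolyOfSatake`). [folklore] -/
theorem arithFrobPolyOfSatake_injective (ι : PadicAlgCl ℓ ≃+* ℂ) {q : ℕ} (hq : q ≠ 0) (m : ℕ) :
    Function.Injective (arithFrobPolyOfSatake ι q m) := by
  intro α β h
  have hr := congrArg Polynomial.roots h
  rw [roots_arithFrobPolyOfSatake, roots_arithFrobPolyOfSatake] at hr
  exact Multiset.map_injective (root_injective ι hq m) hr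

/-- The residue cardinality of a finite place of a number field is non-zero. [folklore] -/
theorem residueCard_ne_zero (v : HeightOneSpectrum (𝓞 K)) : v.residueCard ≠ 0 :=
  (Literature.NumberTheory.LFunctions.absNorm_heightOneSpectrum_pos v).ne'

/-- ANY WITNESS PINS THE SATAKE PARAMETER: if `ρ` satisfies the crux's Frobenius clause at `v` for
`β` and for `β'`, then `β = β'` (a Frobenius at `v` exists — `primesAbove_nonempty`,
`exists_isArithFrobAt_of_mem_primesAbove_holds`, both proved — and the predicted polynomial is
injective in `β`). Hence the crux implies a.e. uniqueness of Satake parameters along `σ`; this is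
no contradiction because uniqueness holds outright (`AutomorphicRepData.hasSatakeParamAt_unique_holds`),
which closes the "two Satake parameters" attack. [folklore] -/
theorem witness_pins_satake {n m : ℕ} (ι : PadicAlgCl ℓ ≃+* ℂ) {ρ : FramedGaloisRep K (PadicAlgCl ℓ) n}
    {v : HeightOneSpectrum (𝓞 K)} {β β' : Multiset ℂ}
    (h : ρ.HasFrobCharpolyAt v (arithFrobPolyOfSatake ι v.residueCard m β))
    (h' : ρ.HasFrobCharpolyAt v (arithFrobPolyOfSatake ι v.residueCard m β')) : β = β' := by
  obtain ⟨𝔓, h𝔓⟩ := HeightOneSpectrum.primesAbove_nonempty v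
  obtain ⟨τ, hτ⟩ := HeightOneSpectrum.exists_isArithFrobAt_of_mem_primesAbove_holds h𝔓
  exact arithFrobPolyOfSatake_injective ι (residueCard_ne_zero v) m
    ((h 𝔓 h𝔓 τ hτ).symm.trans (h' 𝔓 h𝔓 τ hτ))

/-- The trivial representation has Frobenius characteristic polynomial `(X - 1)²` at every place,
and only that one. [folklore] -/
theorem hasFrobCharpolyAt_one_iff (v : HeightOneSpectrum (𝓞 K)) (P : (PadicAlgCl ℓ)[X]) :
    (1 : FramedGaloisRep K (PadicAlgCl ℓ) 2).HasFrobCharpolyAt v P ↔ P = (X - 1) ^ 2 := by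
  constructor
  · intro h
    obtain ⟨𝔓, h𝔓⟩ := HeightOneSpectrum.primesAbove_nonempty v
    obtain ⟨τ, hτ⟩ := HeightOneSpectrum.exists_isArithFrobAt_of_mem_primesAbove_holds h𝔓
    rw [← h 𝔓 h𝔓 τ hτ]
    simp [FramedRep.charpoly, Matrix.charpoly_one]
  · rintro rfl 𝔓 _ τ _
    simp [FramedRep.charpoly, Matrix.charpoly_one]

/-- THE TRIVIAL REPRESENTATION IS NOT A WITNESS: if `ρ = 1` satisfies the crux's Frobenius clause
at `v` for the multiset `β`, then every `b ∈ β` equals `q_v^{-1/2}` — the Satake parameter of the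
Eisenstein constituent `|det|^{1/2} ⊗ (1 ⊞ 1)`, never that of a cuspidal `σ_v` (unitary central
character forces `|e₂(β)| = 1 ≠ q_v⁻¹`). So the `∃ ρ` is not junk-dischargeable. [folklore] -/
theorem trivial_witness_forces (ι : PadicAlgCl ℓ ≃+* ℂ) {v : HeightOneSpectrum (𝓞 K)}
    {β : Multiset ℂ}
    (h : (1 : FramedGaloisRep K (PadicAlgCl ℓ) 2).HasFrobCharpolyAt v
      (arithFrobPolyOfSatake ι v.residueCard 2 β)) :
    Multiset.card β = 2 ∧ ∀ b ∈ β, ((Real.sqrt v.residueCard : ℝ) : ℂ) * b = 1 := by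
  rw [hasFrobCharpolyAt_one_iff] at h
  refine ⟨?_, fun b hb => ?_⟩
  · have hd := natDegree_arithFrobPolyOfSatake ι v.residueCard 2 β
    rw [h] at hd
    have h2 : ((X - 1 : (PadicAlgCl ℓ)[X]) ^ 2).natDegree = 2 := by
      rw [← C_1, natDegree_pow, natDegree_X_sub_C]
    omega
  · have hroot : ι.symm (((Real.sqrt v.residueCard : ℝ) : ℂ) ^ (2 - 1) * b)⁻¹ ∈
        (arithFrobPolyOfSatake ι v.residueCard 2 β).roots := by
      rw [roots_arithFrobPolyOfSatake]
      exact Multiset.mem_map_of_mem _ hb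
    rw [h] at hroot
    have hx : ι.symm (((Real.sqrt v.residueCard : ℝ) : ℂ) ^ (2 - 1) * b)⁻¹ = 1 := by
      have := Polynomial.isRoot_of_mem_roots hroot
      simp only [IsRoot.def, eval_pow, eval_sub, eval_X, eval_one] at this
      exact sub_eq_zero.mp (pow_eq_zero_iff (n := 2) (by norm_num) |>.mp this)
    have hy : (((Real.sqrt v.residueCard : ℝ) : ℂ) ^ (2 - 1) * b)⁻¹ = 1 := by
      apply ι.symm.injective
      rw [hx, map_one]
    simpa using inv_eq_one.mp hy

end Junk

/-! ## §C Natural strengthenings (records; refutations need `H_σ`)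
* `CruxEverywhere` — false on paper (§A, MUTATION 4).
* uniqueness of `ρ` up to conjugacy — true on paper for the semisimple witness (Chebotarev +
  Brauer–Nesbitt, in tree: `FramedGaloisRep.nonempty_equiv_of_hasFrobCharpolyAt_eventually`), false
  as stated without semisimplicity (a non-split extension of the two characters of a reducible…
  — not applicable: witnesses for cuspidal `σ` are irreducible); not part of the crux.
* independence of `ι` / rationality over a number field — true on paper (compatible system), not
  part of the crux.

## Targets
None: no line picked, `stuck_stubs = []` (cycle 1). -/

end Summit.Langlands.Langlands.Cruxes.GaloisRepGL2CMae.Disproof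

end
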